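import Summits.QuantumFields.BalabanUV.Beta.FP.PeriodisedCoarseWardContact
import Summits.QuantumFields.BalabanUV.Beta.FP.TorusCombRows

/-!
# `BalabanUV.Beta.FP.PeriodisedRowsLevelUp` — road «FP» for binder row D1, ROUTE T, presentation T-β: **leaf-02's ROWS ONE LEVEL UP** — the level-`j`
# COARSE letters of the torus call (insertion family `Q₂₁`, coarse generator block `D̄`, coarse generator jet `D̄₁`) ARE the level-`(j+1)` FINE letters
# (insertion family `Q′₁₁`, fine generator block `D′₁`, fine part of the generator jet `W′₁`) along the TRANSPORTED direction `h̄`, up to ONE scale `s`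

WHY (OWNER d1-p3 g19 W-FP-19-11 «THIS SHAPE — WANTED»; g18 Q-g19-1 «YES, the next row = level-(j+1) twins of q1 ∕ c1 d1»).  The graded two-term law at the torus
(`NestedStepLawTorusTransportedRowsGradedLevelUp`: one-shot `(j, 2)` = one-step `(j)` + one-step `(j+1)`) ITERATES only if the right-hand level-`(j+1)` system
appears in the `(j+1)`-call's OWN letter shapes.  For leaf-02's rows this is pure re-presentation, no table identity: with the torus call's defining
equations (p313662 ∕ p316503 ∕ p317562 ∕ p318378 VERBATIM) —

* `Q21_eq_levelUp_family`: the level-`j` coarse insertion family `Q₂₁^{(w)}` (transported by `θ_j · Q₁₀`, `hQ₂₁` of p317562 ∕ the call) IS the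
  level-`(j+1)` fine insertion family `Q′₁₁^{(h̄)}` (leaf-02's `hQ₁₁` shape ONE LEVEL UP, in the κ-presentation `pμ′ mμ′` of the coarse multipliers) along
  the transported direction `h̄`, `h̄ a′ = Σ_b θ_j · Q₁₀ a′ b · w b` — a sum swap;
* `Dbar_eq_smul_levelUp_D1`: the coarse generator block `D̄` (`hDbar`) `= s • D′₁`, `D′₁` the level-`(j+1)` fine generator block (`hD₁` shape at `(M′, r′)`),
  `s = stepScale_j · #B`;
* `Db1_eq_smul_levelUp_W1`: the coarse generator first jet `D̄₁^{(w)}` (`hDb₁`) `= s • W′₁|_fine^{(h̄)}`, the fine part of the level-`(j+1)` generator jet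
  along `h̄` (`c_{j+1} = (Lc^{d+1} · stepScale_{j+1})⁻¹`).

As the OWNER asked (W-FP-19-11), the scale `s` and the direction map `w ↦ h̄` are DISPLAYED as named hypotheses (`hs`, `hhbar`), not inlined, so that a
telescoping file can quantify over levels.  [folklore] finite sums and scalars over OUR typed torus objects; no `def`, no `def … : Prop`, nothing cited,
0 sorry.  Nothing of the dictionary asserted (which slot presentation the `(j+1)`-call takes — `κ ∕ pμ′ mμ′` vs `coarsePt` — is the OWNER's choice; the
lemmas are stated in the κ-presentation the level-`j` call's coarse system already uses).

HONEST DEPENDENCY (page 1, mandatory): continuum YM on T⁴ ⇐ BetaPertH ∧ nine spine estimates (0/9 proved); BetaPertH ⇐ (D1) ∧ (D4) ∧ CAP+tail;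
G-an2-4 gates asym, D1 and NE2/3/4.  HONEST FRAMING (cell contract, verbatim): «discharging `BetaPertH` makes Bałaban's UV stability UNCONDITIONAL —
a real constructive-QFT result; it is NOT the continuum limit and NOT the Clay problem.»  ABSOLUTE RULE (cell charter, verbatim): «No internally-minted
statement may enter as a cited fact. Every hypothesis is either kernel-proved in this package or a verbatim quotation of a PUBLISHED theorem with page
reference. The manuscript(s) under audit are NOT citable for their own disputed steps — they are the thing under adjudication; programme-internal
(2001/route/tribunal) claims are never citable.»  0 estimates; 0∕4 row-D1 binders; NOT (T-ID)∕(T-β) complete, NOT SDF, NOT D1, NOT BetaPertH, NOT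
continuum, NOT Clay.  Road «FP», D1 formalisation swarm leaf-02 (b2b-balaban-beta-d1-formalise-leaf-02) gen 20, 2026-08-22 (O-d1leaf02g19-3, g19 scratch
9b617f1a4c48e9d6 → OWNER W-FP-19-11).  No existing file touched.
-/

noncomputable section

open scoped BigOperators

namespace Summit.QuantumFields.BalabanUV.Beta.FP.PeriodisedRowsLevelUp

open Matrix Finset
open Literature.MathematicalPhysics.QuantumFieldTheory.Balaban1983to89
open Literature.MathematicalPhysics.QuantumFieldTheory.Balaban1983to89.Beta
open Literature.MathematicalPhysics.QuantumFieldTheory.LatticeForm (quo)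
open B5Prop11Plancherel (fine)
open B6Lemma24Torus (pbox)
open AffineAveraging (Site box toSite unitVec)
open AveragingHessianKernelsRooted (vhSAt)
open OneStepResolventKernel (Fib)
open Summit.QuantumFields.BalabanUV.Beta.BorderedHessian (stepScale)
open Summit.QuantumFields.BalabanUV.Beta.FP.KernelPeriodisationFib (Idx perF)
open Summit.QuantumFields.BalabanUV.Beta.FP.KernelPeriodisationFibLoc (dper)
open Summit.QuantumFields.BalabanUV.Beta.FP.TorusGaugeCovariance (tdelta tgrad)
open Summit.QuantumFields.BalabanUV.Beta.FP.TorusCombRows (Res)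

variable {d : ℕ} (M' : Fin (d + 1) → ℕ) [∀ μ, NeZero (M' μ)] {Lc : ℕ} [NeZero Lc] {r' : Fin (d + 1) → ℕ}

omit [∀ μ, NeZero (M' μ)] [NeZero Lc] in
/-- [folklore] **THE COARSE INSERTION FAMILY OF LEVEL `j` IS THE FINE INSERTION FAMILY OF LEVEL `j+1` ALONG THE TRANSPORTED DIRECTION.**  With `Q₂₁`
bound by the torus call's `hQ₂₁` (p317562 ∕ p320614 shape: `Q₂₁ w = Σ_b w b • Σ_{a′} (θ_j·Q₁₀ a′ b) • T a′`, `T a′` the level-`(j+1)` one-slot table at the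
coarse bond `a′` in the κ-presentation), `Q′₁₁ v := Σ_{a′} v a′ • T a′` (leaf-02's `hQ₁₁` family shape ONE LEVEL UP) and the transported direction NAMED
(`hhbar : h̄ = fun a′ => Σ_b θ_j·Q₁₀ a′ b·w b`): `Q₂₁ w = Q′₁₁ h̄` — a sum swap, no table identity. -/
theorem Q21_eq_levelUp_family (j : ℕ) {κ : Type*} [Fintype κ] (pμ' : κ → ↥(pbox M')) (mμ' : κ → Fin (d + 1))
    (Q₁₀ : Matrix (↥(pbox M') × Fin (d + 1)) (↥(pbox (fine Lc M')) × Fin (d + 1)) ℝ)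
    (Q₂₁ : (↥(pbox (fine Lc M')) × Fin (d + 1) → ℝ) → Matrix κ (↥(pbox M') × Fin (d + 1)) ℝ)
    (hQ₂₁ : ∀ w, Q₂₁ w = ∑ b : ↥(pbox (fine Lc M')) × Fin (d + 1), w b •
        ∑ a' : ↥(pbox M') × Fin (d + 1), (stepScale d Lc (j + 1) / (stepScale d Lc j ^ 2 * ((box (d + 1) Lc).card : ℝ)) * Q₁₀ a' b) •
          (perF M' (dper M' (vhSAt (toSite r') d Lc rfl a'.2 (a'.1 : Site (d + 1))))).submatrix (fun a : κ => ((pμ' a, Sum.inr (mμ' a)) : Idx M' (Fib d)))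
            (fun b : ↥(pbox M') × Fin (d + 1) => ((b.1, Sum.inl b.2) : Idx M' (Fib d))))
    (Q'₁₁ : (↥(pbox M') × Fin (d + 1) → ℝ) → Matrix κ (↥(pbox M') × Fin (d + 1)) ℝ)
    (hQ'₁₁ : ∀ v, Q'₁₁ v = ∑ a' : ↥(pbox M') × Fin (d + 1), v a' •
        (perF M' (dper M' (vhSAt (toSite r') d Lc rfl a'.2 (a'.1 : Site (d + 1))))).submatrix (fun a : κ => ((pμ' a, Sum.inr (mμ' a)) : Idx M' (Fib d)))
          (fun b : ↥(pbox M') × Fin (d + 1) => ((b.1, Sum.inl b.2) : Idx M' (Fib d))))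
    (w : ↥(pbox (fine Lc M')) × Fin (d + 1) → ℝ)
    -- the TRANSPORTED direction, NAMED
    {hbar : ↥(pbox M') × Fin (d + 1) → ℝ}
    (hhbar : hbar = fun a' => ∑ b : ↥(pbox (fine Lc M')) × Fin (d + 1),
      (stepScale d Lc (j + 1) / (stepScale d Lc j ^ 2 * ((box (d + 1) Lc).card : ℝ)) * Q₁₀ a' b) * w b) :
    Q₂₁ w = Q'₁₁ hbar := by
  subst hhbar
  rw [hQ₂₁, hQ'₁₁]
  simp only [Finset.smul_sum, smul_smul, Finset.sum_smul]
  rw [Finset.sum_comm]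
  refine Finset.sum_congr rfl fun a' _ => Finset.sum_congr rfl fun b _ => ?_
  rw [mul_comm (w b)]

omit [∀ μ, NeZero (M' μ)] [NeZero Lc] in
/-- [folklore] **THE COARSE GENERATOR BLOCK OF LEVEL `j` IS A SCALAR MULTIPLE OF THE FINE GENERATOR BLOCK OF LEVEL `j+1`**: with the call's `hDbar`
(p313662 ∕ the Delta ∕ p320614 VERBATIM), the level-`(j+1)` fine block `D′₁` (the call's `hD₁` shape at `(M′, r′)`) and the scale NAMED
(`hs : s = stepScale_j · #B`): `D̄ = s • D′₁`. -/
theorem Dbar_eq_smul_levelUp_D1 (j : ℕ)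
    {Dbar D'₁ : Matrix (↥(pbox M') × Fin (d + 1)) (Res (toSite r') Lc M') ℝ}
    (hDbar : Dbar = Matrix.of fun (a : ↥(pbox M') × Fin (d + 1)) (t : Res (toSite r') Lc M') =>
        stepScale d Lc j * (((box (d + 1) Lc).card : ℝ) * tgrad M' (a.1, Sum.inl a.2) t.1))
    (hD'₁ : D'₁ = (tgrad M').submatrix (fun b : ↥(pbox M') × Fin (d + 1) => ((b.1, Sum.inl b.2) : Idx M' (Fib d)))
        (Subtype.val : Res (toSite r') Lc M' → ↥(pbox M')))
    -- the SCALE, NAMED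
    {s : ℝ} (hs : s = stepScale d Lc j * ((box (d + 1) Lc).card : ℝ)) :
    Dbar = s • D'₁ := by
  subst hs
  rw [hDbar]
  ext a t
  have hD : D'₁ a t = tgrad M' (a.1, Sum.inl a.2) t.1 := by rw [hD'₁]; rfl
  rw [Matrix.smul_apply, hD, Matrix.of_apply, smul_eq_mul, mul_assoc]

omit [∀ μ, NeZero (M' μ)] in
/-- [folklore] **THE COARSE GENERATOR FIRST JET OF LEVEL `j` ALONG `w` IS THE SAME SCALAR MULTIPLE OF THE FINE PART OF THE LEVEL-`(j+1)` GENERATOR FIRST JET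
ALONG THE TRANSPORTED DIRECTION `h̄`**: with p314580 ∕ p318378's `hDb₁` (level `j`, direction `w`), leaf-02's generator-jet shape ONE LEVEL UP restricted to the
fine residual parameters of `M′` (`W′₁|_fine^{(v)} (a, t) = −c_{j+1} · v a · [a⁺ = t]`, `c_{j+1} = (Lc^{d+1} · stepScale_{j+1})⁻¹`), the scale `hs` and the
direction `hhbar` NAMED: `D̄₁^{(w)} = s • W′₁|_fine^{(h̄)}` — the `d1` row of level `j` is `s` times the fine part of the `c1` row of level `j+1`. -/
theorem Db1_eq_smul_levelUp_W1 (j : ℕ) (Q₁₀ : Matrix (↥(pbox M') × Fin (d + 1)) (↥(pbox (fine Lc M')) × Fin (d + 1)) ℝ)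
    (w : ↥(pbox (fine Lc M')) × Fin (d + 1) → ℝ)
    {hbar : ↥(pbox M') × Fin (d + 1) → ℝ}
    (hhbar : hbar = fun a' => ∑ b : ↥(pbox (fine Lc M')) × Fin (d + 1),
      (stepScale d Lc (j + 1) / (stepScale d Lc j ^ 2 * ((box (d + 1) Lc).card : ℝ)) * Q₁₀ a' b) * w b)
    {s : ℝ} (hs : s = stepScale d Lc j * ((box (d + 1) Lc).card : ℝ))
    {Db₁ W'₁f : Matrix (↥(pbox M') × Fin (d + 1)) (Res (toSite r') Lc M') ℝ}
    (hDb₁ : Db₁ = ∑ b : ↥(pbox (fine Lc M')) × Fin (d + 1), w b •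
        Matrix.of fun (a : ↥(pbox M') × Fin (d + 1)) (t : Res (toSite r') Lc M') =>
          -((((Lc : ℝ) ^ (d + 1) * stepScale d Lc j)⁻¹) * Q₁₀ a b * tdelta M' ((a.1 : Site (d + 1)) + unitVec a.2) t.1))
    (hW'₁f : W'₁f = Matrix.of fun (a : ↥(pbox M') × Fin (d + 1)) (t : Res (toSite r') Lc M') =>
        -((((Lc : ℝ) ^ (d + 1) * stepScale d Lc (j + 1))⁻¹) * hbar a * tdelta M' ((a.1 : Site (d + 1)) + unitVec a.2) t.1)) :
    Db₁ = s • W'₁f := by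
  subst hhbar hs
  have hsj : stepScale d Lc j ≠ 0 := BorderedHessian.stepScale_ne_zero (d := d) (Lc := Lc) j
  have hsj' : stepScale d Lc (j + 1) ≠ 0 := BorderedHessian.stepScale_ne_zero (d := d) (Lc := Lc) (j + 1)
  have hB : ((box (d + 1) Lc).card : ℝ) ≠ 0 := by
    have : 0 < (box (d + 1) Lc).card := Finset.card_pos.mpr ⟨fun _ => 0, by
      simp only [AffineAveraging.box, Fintype.mem_piFinset, Finset.mem_range]; intro i; exact Nat.pos_of_ne_zero (NeZero.ne Lc)⟩
    exact_mod_cast this.ne'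
  have hL : ((Lc : ℝ) ^ (d + 1)) ≠ 0 := pow_ne_zero _ (by exact_mod_cast (NeZero.ne Lc))
  rw [hDb₁, hW'₁f]
  ext a t
  simp only [Matrix.sum_apply, Matrix.smul_apply, Matrix.of_apply, smul_eq_mul, Finset.sum_mul, Finset.mul_sum, mul_neg,
    Finset.sum_neg_distrib]
  refine congrArg Neg.neg (Finset.sum_congr rfl fun b _ => ?_)
  field_simp

end Summit.QuantumFields.BalabanUV.Beta.FP.PeriodisedRowsLevelUp

end
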